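import Literature.Barriers.NavierStokesRegularity.CriticalDataSmoothNonuniqueness
import Literature.Analysis.FunctionSpaces.TorusClassicalNSGluing
import HarnessLib

/-!
# Barrier audit (D-0021): the exact uniqueness principle refuted by Coiculescu–Palasek 2025,
# and the uniqueness principles it leaves standing

Audit companion (refuter barrier audit, 2026-08-16) of the catalogue entry
`Literature.Barriers.NavierStokesRegularity.CriticalDataSmoothNonuniqueness`
(M. P. Coiculescu, S. Palasek, *Non-uniqueness of smooth solutions of the Navier–Stokes equations
from critical data*, Invent. Math. 244 (2025), 165–219 = arXiv:2503.14699, Thm. 1.2 with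
Rmk. 1.3). The entry files the barrier under the technique classes
`critical-space-wellposedness large-data-perturbative-theory koch-tataru-class-uniqueness
smooth-solution-selection mild-solution-uniqueness critical-spaces mild-solutions` and its
`blocks:` line names "the large-data extension of the in-tree Koch–Tataru theorem". The audit
found the formal fact faithful (weaker than print, non-vacuous, no junk witness: see
`hasZeroMean_of_sqrt_mul_norm_le` below for why the global `√t`-bound excludes the Galilean /
constant witnesses that the `Ḣ⁻¹`-SEMInorm datum clauses alone would admit) but the CLAIMED
COVERAGE narrower than tagged, in three layers.

* **What the theorem refutes (exactly).** Uniqueness in the class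
  `𝒦 = {(u,p) classical on (0,∞) × 𝕋³, sup_{t>0} √t‖u(t)‖_∞ < ∞}` for data attained in the
  `Ẇ^{-1,p}`, `p < ∞`, sense — in print `u⁽ⁱ⁾ ∈ C^∞_{t,x}((0,∞) × 𝕋³) ∩ L^∞([0,∞); BMO⁻¹) ∩
  C⁰([0,∞); Ẇ^{-1,p})` with finite Koch–Tataru norm [Coiculescu–Palasek 2025, Thm. 1.2,
  Rmk. 1.3]. Note `L^∞_t BMO⁻¹`, NOT `C_t BMO⁻¹`: the solutions are continuous at `t = 0` only
  in the SUPERcritical norms `Ẇ^{-1,p}`, `p < ∞`, and "are not perturbative around zero"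
  [ibid., Rmk. 1.3]; the datum is a lacunary sum of blocks whose `BMO⁻¹`-size does not decay
  with the level (`‖V⁰_{k+1}‖_∞/N_{k+1} ≈ C₁(‖V⁰_k‖_∞/N_k)^{1/2}`, ibid. §1.3.2), so (one checks)
  it lies outside the `BMO⁻¹`-closure of `L^∞(𝕋³)` and NO solution bounded for `t > 0` can be
  `BMO⁻¹`-norm-continuous at `t = 0` from it. The theorem `CriticalDataSmoothNonuniquenessNarrow`
  below states the refuted principle over the accepted torus vocabulary with EVERY property the
  formal fact supplies as a hypothesis (classical on `(0,∞)`, zero mean, the global `√t`-bound,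
  `H⁻¹`-continuity at positive times, common datum in `Ḣ⁻¹`-norm with each solution Cauchy in
  `Ḣ⁻¹`, convergent distributional pairings), and `criticalDataSmoothNonuniqueness_iff_not_unique`
  records that the catalogue fact is EQUIVALENT to the failure of that one principle — nothing
  more is formalised.
* **Not covered: uniqueness under norm-continuity at `t = 0⁺` into the critical space.** Mild
  solutions in `C([0,T); bmo⁻¹(ℝ³)) ∩ L^∞_loc((0,T); L^∞(ℝ³))` from `vmo⁻¹` data are unique
  [Miura 2005, §1 and Thm. 2.3: "Behavior of the solution near `t = 0` plays an essential role
  for validity of uniqueness of mild solutions"]; so are mild solutions in `C([0,T); L³(ℝ³))`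
  [Furioli–Lemarié-Rieusset–Terraneo 2000; Lions–Masmoudi 2001; recalled as Prop. 1.1 of
  Fujii 2026] and, more generally, in `C([0,T); Ḃ^{3/p-1}_{p,q}(ℝ³))` for `p < 3` or
  `p = 3, q ≤ 2` [Fujii 2026, Prop. 1.1]. Every solution smooth on `[0,T) × 𝕋³` from smooth
  (e.g. Clay-type) data lies in Miura's class. Coiculescu–Palasek themselves list these classes
  as "well-behaved" critical classes [Coiculescu–Palasek 2025, Rmk. 1.4, citing Miura 2005,
  Auscher–Dubois–Tchamitchian 2004, Lemarié-Rieusset 2007, May 2010, …].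
* **Not covered: Koch–Tataru's own LARGE-data theory for `vmo⁻¹`-type data.** For `u₀` in the
  closure of bounded (or test) functions in `bmo⁻¹` — a class containing `L³`, `Ḣ^{1/2}`,
  `Ḃ^{-1+3/p}_{p,q}` with `q < ∞`, and all Schwartz / smooth periodic data, but no non-zero
  scale-invariant datum and not the Coiculescu–Palasek datum — one has
  `lim_{T→0} ‖1_{0<t<T} e^{νtΔ}u₀‖_{E_T} = 0`, hence a LOCAL mild solution for arbitrarily large
  such data, unique in the ball `‖u‖_{E_T} ≤ C₀ε₀` of the Koch–Tataru path space
  [Lemarié-Rieusset 2016, Thm. 9.2 and the existence criteria following it, pp. 198–199], and the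
  Brezis–Miura argument identifies every `bmo⁻¹`-continuous bounded-for-`t>0` solution with it
  [Lemarié-Rieusset 2016, proof of Thm. 9.11, pp. 236–237 with footnote 2]. What the barrier
  blocks of `Literature.Analysis.FluidPDE.koch_tataru` (ns.S15) is precisely the removal of the
  SMALLNESS hypothesis while keeping only membership in the path space as the uniqueness class —
  not the large-data local theorem, and not the existence half of "well-posedness" (both printed
  solutions exist globally).
* **What is NOT an evasion (neighbouring entries).** Smoothness of the datum alone: from EVERY
  smooth divergence-free datum on `𝕋ᵈ` there is, besides the classical solution, a weak solution
  classical for `t > 0` with Type-I growth at `t = 0⁺`, weak-* continuous into `BMO⁻¹`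
  [Cheskidov–Dai–Palasek 2025, Thm. 1.1 with `T_* = 0`; entry `InstantaneousTypeIBlowup`]; and
  continuity in a critical norm WITHOUT boundedness for `t > 0`: unconditional uniqueness of
  mild solutions in `C([0,T); Ḃ^{3/p-1}_{p,q})`, `p > 3` or `p = 3, q > 2`, fails even from the
  zero datum, on `ℝ³` and on `𝕋³`, by rough solutions [Fujii 2026, Thm. 1.2 and Rmk. 1.3; entry
  `CriticalBesovSteadyNonuniqueness`]. The two hypotheses of Miura's class — norm-continuity at
  `0⁺` in the critical space, local boundedness for `t > 0` — are thus separately necessary.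
* **Scope updates.** The `𝕋²` analogue left open in [Coiculescu–Palasek 2025, Rmk. 1.7] is now
  claimed (C. Miao, Y. Nie et al., *Non-uniqueness of smooth solutions to the Navier–Stokes
  equations on torus `𝕋²`*, arXiv:2602.19074, Thm. 1.1: two global solutions in
  `C^∞(ℝ⁺ × 𝕋²) ∩ L^∞_t BMO⁻¹(𝕋²)`); the `ℝ³` / `ℝ²` versions remain "expected".

Contents (all proved, no named fact, no definition): `hasZeroMean_of_sqrt_mul_norm_le` (an
unforced classical solution on `(0,∞) × 𝕋³` obeying `√t‖u(t)‖_∞ ≤ M` for all `t > 0` has zero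
mean at every positive time: the mean is conserved and bounded by `M/√t → 0`),
`CriticalDataSmoothNonuniquenessNarrow` (the refuted uniqueness principle, sharpest formal form),
`criticalDataSmoothNonuniqueness_iff_not_unique` (normal form of the catalogue fact).

## References

* M. P. Coiculescu, S. Palasek, Invent. Math. 244 (2025), 165–219; arXiv:2503.14699.
  [`CoiculescuPalasek2025`]
* H. Miura, *Remark on uniqueness of mild solutions to the Navier–Stokes equations*, J. Funct.
  Anal. 218 (2005), 110–129. [`Miura2005`]
* P. G. Lemarié-Rieusset, *The Navier–Stokes Problem in the 21st Century*, CRC 2016, Thm. 9.2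
  (pp. 198–199), Thm. 9.11 (pp. 235–237). [`LemarieRieusset2016`]
* G. Furioli, P. G. Lemarié-Rieusset, E. Terraneo, Rev. Mat. Iberoam. 16 (2000).
  [`FurioliLemarierieussetTerraneo2000`]; P.-L. Lions, N. Masmoudi, Nonlinearity 14 (2001).
  [`LionsMasmoudi2001`]
* M. Fujii, *Sharp non-uniqueness for the Navier–Stokes equations in scaling critical spaces*,
  arXiv:2602.19846 (2026), Prop. 1.1, Thm. 1.2, Rmk. 1.3. [`Fujii2026`]
* A. Cheskidov, M. Dai, S. Palasek, arXiv:2511.09556 (2025), Thm. 1.1. [`CheskidovDaiPalasek2025`]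
* H. Koch, D. Tataru, Adv. Math. 157 (2001). [`KochTataruAdvMath2001`]
-/

noncomputable section

open MeasureTheory Set Filter Topology
open scoped InnerProductSpace RealInnerProductSpace

namespace Literature.Barriers.NavierStokesRegularity

open Literature.Analysis.FunctionSpaces

/-- **The global Koch–Tataru `L^∞` bound forces zero mean.** If `(u, p)` is a classical solution
of the unforced Navier–Stokes equations on `(0,∞) × 𝕋³` (any viscosity `ν`) with
`√t ‖u(t,x)‖ ≤ M` for all `t > 0` and all `x`, then `∫ u(t) = 0` for every `t > 0`: the spatial
mean is conserved on the convex time set `(0,∞)`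
(`Torus.IsClassicalNSSolutionOn.integral_velocity_eq`) and, the torus having unit volume,
`‖∫ u(t)‖ = ‖∫ u(s)‖ ≤ M/√s → 0` as `s → ∞`. This is why the catalogue fact
`CriticalDataSmoothNonuniqueness`, whose datum clauses only see the `Ḣ⁻¹` SEMInorm and mean-zero
test fields, nevertheless admits no Galilean-boost or constant-field junk witnesses. [folklore] -/
theorem hasZeroMean_of_sqrt_mul_norm_le {ν : ℝ}
    {u : ℝ → UnitAddTorus (Fin 3) → EuclideanSpace ℝ (Fin 3)} {p : ℝ → UnitAddTorus (Fin 3) → ℝ}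
    (hu : Torus.IsClassicalNSSolutionOn (Ioi 0) ν 0 u p) {M : ℝ}
    (hM : ∀ t : ℝ, 0 < t → ∀ x, Real.sqrt t * ‖u t x‖ ≤ M) {t : ℝ} (ht : 0 < t) :
    Torus.HasZeroMean (u t) := by
  -- the mean is conserved on `(0, ∞)` (zero force has zero mean)
  have hf : ∀ τ ∈ Ioi (0 : ℝ),
      ∫ x, (0 : ℝ → UnitAddTorus (Fin 3) → EuclideanSpace ℝ (Fin 3)) τ x = 0 :=
    fun τ _ => by simp
  have hmean : ∀ s : ℝ, 0 < s → ∫ x, u s x = ∫ x, u t x := fun s hs =>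
    hu.integral_velocity_eq (convex_Ioi 0) hf (mem_Ioi.2 ht) (mem_Ioi.2 hs)
  -- and bounded by `M / √s` at every time `s > 0`
  have hbound : ∀ s : ℝ, 0 < s → ‖∫ x, u t x‖ ≤ M / Real.sqrt s := by
    intro s hs
    have hs' : 0 < Real.sqrt s := Real.sqrt_pos.2 hs
    rw [← hmean s hs]
    have h1 : ‖∫ x, u s x‖ ≤
        M / Real.sqrt s * (volume : Measure (UnitAddTorus (Fin 3))).real univ :=
      norm_integral_le_of_norm_le_const (Eventually.of_forall fun x => by
        rw [le_div_iff₀ hs', mul_comm]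
        exact hM s hs x)
    simpa using h1
  -- `M / √s → 0` as `s → ∞`
  have hlim : Tendsto (fun s : ℝ => M / Real.sqrt s) atTop (𝓝 0) := by
    have h := (tendsto_inv_atTop_zero.comp Real.tendsto_sqrt_atTop).const_mul M
    simpa [div_eq_mul_inv, Function.comp_def] using h
  have h0 : ‖∫ x, u t x‖ ≤ 0 :=
    ge_of_tendsto hlim ((eventually_gt_atTop 0).mono fun s hs => hbound s hs)
  exact norm_le_zero_iff.1 h0

/-- **Barrier audit (D-0021), narrowed form: the exact uniqueness principle refuted by
Coiculescu–Palasek 2025 in the formal class of the catalogue rendering.** It is NOT the case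
that two classical solutions `(u,p₁)`, `(v,p₂)` of the unforced Navier–Stokes equations
(`ν = 1`) on `(0,∞) × 𝕋³`, both of zero mean at all positive times, both obeying the global
Koch–Tataru-type bound `√t‖·(t)‖_∞ ≤ M`, both continuous in `H⁻¹(𝕋³)` at positive times, with a
common datum in the strongest sense the catalogue fact offers — `‖u(t) - v(t)‖_{Ḣ⁻¹} → 0`, each
of `u(t)`, `v(t)` Cauchy in `Ḣ⁻¹` as `t → 0⁺`, and convergent distributional pairings against
every smooth mean-zero field with vanishing difference — must coincide at all positive times.
AUDIT READING: every hypothesis here is a property of the solutions on `(0,∞)` or a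
SUPERcritical-norm (`Ḣ⁻¹ = Ẇ^{-1,2}`) / distributional mode of attaining the datum; the principle
carries NO norm-continuity at `t = 0⁺` into a critical space, and that is exactly the hypothesis
under which uniqueness is a theorem: `C([0,T); bmo⁻¹) ∩ L^∞_loc((0,T); L^∞)`
[cite: Miura2005, Thm. 2.3],
`C([0,T); L³)` [cite: FurioliLemarierieussetTerraneo2000, Thm. 1], the little Koch–Tataru space
for `vmo⁻¹`-type data [cite: LemarieRieusset2016, Thm. 9.2 and pp. 198–199, 236–237]; in print the
two solutions are in `L^∞_t BMO⁻¹`, not `C_t BMO⁻¹`, and "not perturbative around zero"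
[cite: CoiculescuPalasek2025, Thm. 1.2 and Rmk. 1.3]. Proved from the catalogue fact and
`hasZeroMean_of_sqrt_mul_norm_le`. [cite: CoiculescuPalasek2025, Thm. 1.2 and Rmk. 1.3] -/
theorem CriticalDataSmoothNonuniquenessNarrow (h : CriticalDataSmoothNonuniqueness) :
    ¬ ∀ (u v : ℝ → UnitAddTorus (Fin 3) → EuclideanSpace ℝ (Fin 3))
        (p₁ p₂ : ℝ → UnitAddTorus (Fin 3) → ℝ),
      Torus.IsClassicalNSSolutionOn (Ioi 0) 1 0 u p₁ →
      Torus.IsClassicalNSSolutionOn (Ioi 0) 1 0 v p₂ →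
      (∀ t : ℝ, 0 < t → Torus.HasZeroMean (u t)) →
      (∀ t : ℝ, 0 < t → Torus.HasZeroMean (v t)) →
      (∃ M : ℝ, ∀ t : ℝ, 0 < t → ∀ x, Real.sqrt t * ‖u t x‖ ≤ M ∧ Real.sqrt t * ‖v t x‖ ≤ M) →
      Torus.ContinuousInSobolevOn (Ioi 0) (-1) (fun t => EuclideanSpace.complexify ∘ u t) →
      Torus.ContinuousInSobolevOn (Ioi 0) (-1) (fun t => EuclideanSpace.complexify ∘ v t) →
      Tendsto (fun t => Torus.eHomSobolevSeminorm (-1) (EuclideanSpace.complexify ∘ (u t - v t)))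
        (𝓝[>] 0) (𝓝 0) →
      Tendsto (fun st : ℝ × ℝ =>
          Torus.eHomSobolevSeminorm (-1) (EuclideanSpace.complexify ∘ (u st.1 - u st.2)))
        ((𝓝[>] (0 : ℝ)) ×ˢ (𝓝[>] (0 : ℝ))) (𝓝 0) →
      Tendsto (fun st : ℝ × ℝ =>
          Torus.eHomSobolevSeminorm (-1) (EuclideanSpace.complexify ∘ (v st.1 - v st.2)))
        ((𝓝[>] (0 : ℝ)) ×ˢ (𝓝[>] (0 : ℝ))) (𝓝 0) →
      (∀ φ : UnitAddTorus (Fin 3) → EuclideanSpace ℝ (Fin 3),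
        Torus.IsSmooth φ → Torus.HasZeroMean φ →
        (∃ c : ℝ, Tendsto (fun t => ∫ x, ⟪u t x, φ x⟫) (𝓝[>] 0) (𝓝 c)) ∧
        (∃ c : ℝ, Tendsto (fun t => ∫ x, ⟪v t x, φ x⟫) (𝓝[>] 0) (𝓝 c)) ∧
        Tendsto (fun t => ∫ x, ⟪u t x - v t x, φ x⟫) (𝓝[>] 0) (𝓝 0)) →
      ∀ t : ℝ, 0 < t → u t = v t := by
  intro hall
  obtain ⟨u, v, p₁, p₂, hu, hv, ⟨M, hM⟩, hcu, hcv, ⟨t, ht, hne⟩, hdat, hCu, hCv, hφ⟩ := h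
  have hmu : ∀ s : ℝ, 0 < s → Torus.HasZeroMean (u s) := fun s hs =>
    hasZeroMean_of_sqrt_mul_norm_le hu (fun τ hτ x => (hM τ hτ x).1) hs
  have hmv : ∀ s : ℝ, 0 < s → Torus.HasZeroMean (v s) := fun s hs =>
    hasZeroMean_of_sqrt_mul_norm_le hv (fun τ hτ x => (hM τ hτ x).2) hs
  exact hne (hall u v p₁ p₂ hu hv hmu hmv ⟨M, hM⟩ hcu hcv hdat hCu hCv hφ t ht)

/-- **Normal form of the catalogue fact.** `CriticalDataSmoothNonuniqueness` is EQUIVALENT to the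
failure of the uniqueness principle of `CriticalDataSmoothNonuniquenessNarrow` (zero mean of the
witnesses being automatic, `hasZeroMean_of_sqrt_mul_norm_le`): the barrier formalises exactly
"uniqueness fails in the class {classical on `(0,∞) × 𝕋³`, mean zero, `sup_t √t‖·‖_∞ < ∞`,
`C⁰((0,∞); H⁻¹)`} for data attained in `Ḣ⁻¹`-norm and distributionally" — and nothing about
classes with norm-continuity at `t = 0⁺` in a critical space, finite-energy classes, or `ℝ³`
(audit 2026-08-16; see the module docstring).
[cite: CoiculescuPalasek2025, Thm. 1.2 and Rmk. 1.3] -/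
theorem criticalDataSmoothNonuniqueness_iff_not_unique :
    CriticalDataSmoothNonuniqueness ↔
    ¬ ∀ (u v : ℝ → UnitAddTorus (Fin 3) → EuclideanSpace ℝ (Fin 3))
        (p₁ p₂ : ℝ → UnitAddTorus (Fin 3) → ℝ),
      Torus.IsClassicalNSSolutionOn (Ioi 0) 1 0 u p₁ →
      Torus.IsClassicalNSSolutionOn (Ioi 0) 1 0 v p₂ →
      (∀ t : ℝ, 0 < t → Torus.HasZeroMean (u t)) →
      (∀ t : ℝ, 0 < t → Torus.HasZeroMean (v t)) →
      (∃ M : ℝ, ∀ t : ℝ, 0 < t → ∀ x, Real.sqrt t * ‖u t x‖ ≤ M ∧ Real.sqrt t * ‖v t x‖ ≤ M) →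
      Torus.ContinuousInSobolevOn (Ioi 0) (-1) (fun t => EuclideanSpace.complexify ∘ u t) →
      Torus.ContinuousInSobolevOn (Ioi 0) (-1) (fun t => EuclideanSpace.complexify ∘ v t) →
      Tendsto (fun t => Torus.eHomSobolevSeminorm (-1) (EuclideanSpace.complexify ∘ (u t - v t)))
        (𝓝[>] 0) (𝓝 0) →
      Tendsto (fun st : ℝ × ℝ =>
          Torus.eHomSobolevSeminorm (-1) (EuclideanSpace.complexify ∘ (u st.1 - u st.2)))
        ((𝓝[>] (0 : ℝ)) ×ˢ (𝓝[>] (0 : ℝ))) (𝓝 0) →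
      Tendsto (fun st : ℝ × ℝ =>
          Torus.eHomSobolevSeminorm (-1) (EuclideanSpace.complexify ∘ (v st.1 - v st.2)))
        ((𝓝[>] (0 : ℝ)) ×ˢ (𝓝[>] (0 : ℝ))) (𝓝 0) →
      (∀ φ : UnitAddTorus (Fin 3) → EuclideanSpace ℝ (Fin 3),
        Torus.IsSmooth φ → Torus.HasZeroMean φ →
        (∃ c : ℝ, Tendsto (fun t => ∫ x, ⟪u t x, φ x⟫) (𝓝[>] 0) (𝓝 c)) ∧
        (∃ c : ℝ, Tendsto (fun t => ∫ x, ⟪v t x, φ x⟫) (𝓝[>] 0) (𝓝 c)) ∧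
        Tendsto (fun t => ∫ x, ⟪u t x - v t x, φ x⟫) (𝓝[>] 0) (𝓝 0)) →
      ∀ t : ℝ, 0 < t → u t = v t := by
  refine ⟨CriticalDataSmoothNonuniquenessNarrow, fun hnot => ?_⟩
  by_contra hfact
  refine hnot fun u v p₁ p₂ hu hv _ _ hM hcu hcv hdat hCu hCv hφ t ht => ?_
  by_contra hne
  exact hfact ⟨u, v, p₁, p₂, hu, hv, hM, hcu, hcv, ⟨t, ht, hne⟩, hdat, hCu, hCv, hφ⟩

end Literature.Barriers.NavierStokesRegularity
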